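import Literature.MathematicalPhysics.QuantumFieldTheory.BalabanImbrieJaffe1984to88.BIJ88GaussIntegration309Law
import Mathlib.Analysis.InnerProductSpace.Calculus

/-!
# `BalabanImbrieJaffe1984to88.BIJ88ChiPhiDeriv307` — T. Bałaban, J. Imbrie, A. Jaffe, *Effective action and cluster properties of the
abelian Higgs model*, Commun. Math. Phys. **114** (1988) 257–315 [BalabanImbrieJaffe1988]: p. 307 [PDF 51] (Sect. 5.13), the
located sentence *"Functional derivatives hitting χ-factors … produce factors e^{−cp(e_k)²} after integrating with respect to A^{(k)″},
φ^{(k)″}. These derivatives are supported at |A^{(k)″}| ≥ cp(e_k) or |φ^{(k)″}| ≥ cp(e_k)"* — its **scalar-field half**: the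
characteristic functions of the complex field are `χ(q, |φ(x)|)` ((5.2.2): *"χ_x = χ(λ_k p(e_k), |φ(x)|)"*), functions on `ℂ ≅ ℝ²`, and
the functional derivative in `φ(x)` is the (real) Fréchet derivative on `ℂ`.

statement-level skeleton of published theorems with citation tags; proofs where landed; nothing here is a claim about the Yang–Mills mass gap

WHAT THIS FILE ADDS (companion of `BIJ88ChiFieldDeriv307`, the real-field half `χ(q, A_b)`):

* **§1 smoothness and support** — `φ ↦ χ(q, ‖φ‖)` is `C^∞` on `ℂ` as a real plane (`contDiff_cutoff_norm`; near `φ = 0` it is the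
  constant `1`, elsewhere `χ(1,·) ∘ ‖·‖/q`), and for `n ≥ 1`, `q ≠ 0` its n-th Fréchet derivative VANISHES unless
  `(9/10)|q| ≤ ‖φ‖ ≤ |q|` (`iteratedFDeriv_cutoff_norm_eq_zero_of_lt`, `…_of_gt`, `norm_mem_shell_of_iteratedFDeriv_cutoff_norm_ne_zero`) —
  the printed *"supported at |φ^{(k)″}| ≥ cp(e_k)"*.
* **§2 the bound** — `‖Dⁿ[χ(q,‖·‖)](φ)‖ ≤ C(χ,n)·|q|^{−n}` for all `φ` and all `q ≠ 0` (`norm_iteratedFDeriv_cutoff_norm_le`): by evenness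
  `χ(q,‖φ‖) = χ(1, ‖|q|⁻¹φ‖)`, the chain rule for the linear map `φ ↦ |q|⁻¹φ` (Mathlib `ContinuousLinearMap.iteratedFDeriv_comp_right`)
  and the boundedness of the continuous, compactly supported derivatives of `ψ ↦ χ(1,‖ψ‖)`.  (The constant is per order `n`, as in the
  gen-5 t-derivative file `BIJ88ChiTDerivN309`; the Gevrey dependence `cⁿn^{cn}` of (5.2.3) is tracked for the real field in
  `BIJ88ChiFieldDeriv307` and is not re-derived through the norm here.)
* **§3 Gaussian integration** — *"produce factors e^{−cp(e_k)²} after integrating with respect to … φ^{(k)″}"*: for `φ = X + iY` with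
  measurable components and ANY finite measure, `∫‖Dⁿχ(q,|φ|)‖dμ ≤ C|q|^{−n}·μ{(9/10)|q| ≤ |φ|}`
  (`integral_norm_iteratedFDeriv_cutoff_norm_le_measureReal`); for CENTERED Gaussian marginals `X = Re φ`, `Y = Im φ` on any
  probability space (Mathlib `HasGaussianLaw`, NO independence or joint structure)
  `≤ C|q|^{−n}·(2e^{−(81/400)q²/Var X} + 2e^{−(81/400)q²/Var Y})` (`integral_norm_iteratedFDeriv_cutoff_norm_le_of_hasGaussianLaw`, from
  `BIJ88GaussIntegration309Law.real_sqrt_sq_add_sq_ge_le_of_hasGaussianLaw`).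

PDF held: `paper:balaban1988-cmp114-bij-abelian-higgs-effective-action` (journal page = PDF page + 256); p. 307 [PDF 51] and (5.2.2) p. 278
[PDF 22] re-read this generation.

CITATION HEADER (lean-in-tree rule).  Part of the lit-balaban TYPED SKELETON (HOME `run/shared/lean/pub/lit-balaban/`), Phase 2,
seat p36 (gen 7, unit `lit-balaban-p36`); row **C2.Claim@307** of `HOME/lit-balaban-r16/ROWS-C2-part2.md` (owner r16; typed leaves and
p25's `BIJ88SmallPowerPerCube307` untouched).  Theorems only; no definitions, no `Prop` facts; axioms standard.
-/

namespace Literature.MathematicalPhysics.QuantumFieldTheory.BalabanImbrieJaffe1984to88.BIJ88ChiPhiDeriv307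

open MeasureTheory ProbabilityTheory
open BIJ88Sect5Statements (CutoffProfile cutoff)
open BIJ88GaussIntegration309Law (real_sqrt_sq_add_sq_ge_le_of_hasGaussianLaw)
open scoped Topology

/-! ## §1 `φ ↦ χ(q, ‖φ‖)` on `ℂ ≅ ℝ²`: smoothness and support of the Fréchet derivatives -/

section Radial

variable (χ : CutoffProfile)

/-- Evenness of the profile ((5.2.3) *"even"*) lets the threshold enter through `|q|`: `χ(q, r) = χ(1, r/|q|)`.
[cite: BalabanImbrieJaffe1988, (5.2.3)–(5.2.4) p.278] -/
theorem cutoff_eq_chi1_div_abs (q r : ℝ) : cutoff χ q r = χ.χ₁ (r / |q|) := by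
  rcases le_or_gt 0 q with h | h
  · rw [abs_of_nonneg h]; rfl
  · rw [abs_of_neg h, div_neg, χ.even]; rfl

/-- The radial profile `ψ ↦ χ(1, ‖ψ‖)` is `C^∞` on `ℂ` (as a real plane): near `0` it is the constant `1`, away from `0` the norm is
smooth. [cite: BalabanImbrieJaffe1988, (5.2.2)–(5.2.3) p.278] -/
theorem contDiff_chi1_norm {n : ℕ∞} : ContDiff ℝ n (fun ψ : ℂ => χ.χ₁ ‖ψ‖) := by
  rw [contDiff_iff_contDiffAt]
  intro ψ
  by_cases h0 : ψ = 0
  · have hev : (fun ψ : ℂ => χ.χ₁ ‖ψ‖) =ᶠ[𝓝 ψ] fun _ => (1 : ℝ) := by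
      have hlt : ‖ψ‖ < 9 / 10 := by rw [h0, norm_zero]; norm_num
      filter_upwards [continuous_norm.continuousAt.eventually_lt_const hlt] with φ hφ
      exact χ.eq_one _ (by rw [abs_of_nonneg (norm_nonneg φ)]; exact hφ.le)
    exact contDiffAt_const.congr_of_eventuallyEq hev
  · have hχ : ContDiff ℝ n χ.χ₁ := χ.smooth.of_le (by exact_mod_cast le_top)
    exact hχ.contDiffAt.comp ψ (contDiffAt_norm ℝ h0)

/-- Scaling + evenness: `χ(q, ‖φ‖) = χ(1, ‖|q|⁻¹·φ‖)` for `q ≠ 0`. [cite: BalabanImbrieJaffe1988, (5.2.4) p.278] -/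
theorem cutoff_norm_eq_comp {q : ℝ} (hq : q ≠ 0) :
    (fun φ : ℂ => cutoff χ q ‖φ‖) = (fun ψ : ℂ => χ.χ₁ ‖ψ‖) ∘ fun φ : ℂ => (|q|⁻¹ : ℝ) • φ := by
  have hq' : 0 < |q| := abs_pos.mpr hq
  funext φ
  simp only [Function.comp_apply, norm_smul, Real.norm_eq_abs, abs_inv, abs_abs]
  rw [cutoff_eq_chi1_div_abs, div_eq_inv_mul]

/-- `φ ↦ χ(q, ‖φ‖)` is `C^∞` on `ℂ ≅ ℝ²` for every threshold `q` (for `q = 0` it is the constant `χ(1,0)` by the convention `r/0 = 0`).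
[cite: BalabanImbrieJaffe1988, (5.2.2)–(5.2.3) p.278] -/
theorem contDiff_cutoff_norm (q : ℝ) {n : ℕ∞} : ContDiff ℝ n (fun φ : ℂ => cutoff χ q ‖φ‖) := by
  by_cases hq : q = 0
  · have : (fun φ : ℂ => cutoff χ q ‖φ‖) = fun _ => χ.χ₁ 0 := by
      funext φ; simp [cutoff, hq]
    rw [this]; exact contDiff_const
  · rw [cutoff_norm_eq_comp χ hq]
    exact (contDiff_chi1_norm χ).comp (contDiff_id.const_smul (|q|⁻¹ : ℝ))

/-- Below the shell: for `‖φ‖ < (9/10)|q|` the function is locally `1`, so every Fréchet derivative of order `n ≥ 1` vanishes at `φ`.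
[cite: BalabanImbrieJaffe1988, p.307 (Sect. 5.13)] -/
theorem iteratedFDeriv_cutoff_norm_eq_zero_of_lt {n : ℕ} (hn : 1 ≤ n) {q : ℝ} {φ : ℂ} (h : ‖φ‖ < 9 / 10 * |q|) :
    iteratedFDeriv ℝ n (fun φ : ℂ => cutoff χ q ‖φ‖) φ = 0 := by
  have hq : 0 < |q| := by nlinarith [norm_nonneg φ, abs_nonneg q]
  have hev : (fun φ : ℂ => cutoff χ q ‖φ‖) =ᶠ[𝓝 φ] fun _ => (1 : ℝ) := by
    filter_upwards [continuous_norm.continuousAt.eventually_lt_const h] with ψ hψ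
    refine χ.eq_one _ ?_
    rw [abs_div, abs_of_nonneg (norm_nonneg ψ), div_le_iff₀ hq]
    linarith
  rw [(hev.iteratedFDeriv ℝ n).eq_of_nhds, iteratedFDeriv_const_of_ne (by omega)]
  rfl

/-- Above the shell: for `‖φ‖ > |q|`, `q ≠ 0`, the function is locally `0`, so every Fréchet derivative vanishes at `φ`.
[cite: BalabanImbrieJaffe1988, p.307 (Sect. 5.13)] -/
theorem iteratedFDeriv_cutoff_norm_eq_zero_of_gt (n : ℕ) {q : ℝ} (hq : q ≠ 0) {φ : ℂ} (h : |q| < ‖φ‖) :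
    iteratedFDeriv ℝ n (fun φ : ℂ => cutoff χ q ‖φ‖) φ = 0 := by
  have hq' : 0 < |q| := abs_pos.mpr hq
  have hev : (fun φ : ℂ => cutoff χ q ‖φ‖) =ᶠ[𝓝 φ] fun _ => (0 : ℝ) := by
    filter_upwards [continuous_norm.continuousAt.eventually_const_lt h] with ψ hψ
    refine χ.eq_zero _ ?_
    rw [abs_div, abs_of_nonneg (norm_nonneg ψ), le_div_iff₀ hq']
    linarith
  rw [(hev.iteratedFDeriv ℝ n).eq_of_nhds, iteratedFDeriv_fun_zero]
  rfl

/-- **Support** — *"These derivatives are supported at … |φ^{(k)″}| ≥ cp(e_k)"* (sharp form): a non-vanishing Fréchet derivative of order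
`n ≥ 1` of `χ(q, ‖·‖)` (`q ≠ 0`) at `φ` forces `(9/10)|q| ≤ ‖φ‖ ≤ |q|`. [cite: BalabanImbrieJaffe1988, p.307 (Sect. 5.13)] -/
theorem norm_mem_shell_of_iteratedFDeriv_cutoff_norm_ne_zero {n : ℕ} (hn : 1 ≤ n) {q : ℝ} (hq : q ≠ 0) {φ : ℂ}
    (h : iteratedFDeriv ℝ n (fun φ : ℂ => cutoff χ q ‖φ‖) φ ≠ 0) : 9 / 10 * |q| ≤ ‖φ‖ ∧ ‖φ‖ ≤ |q| := by
  by_contra hc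
  rcases not_and_or.mp hc with h1 | h1
  · exact h (iteratedFDeriv_cutoff_norm_eq_zero_of_lt χ hn (not_le.mp h1))
  · exact h (iteratedFDeriv_cutoff_norm_eq_zero_of_gt χ n hq (not_le.mp h1))

end Radial

/-! ## §2 The bound `‖Dⁿ χ(q, ‖·‖)‖ ≤ C(χ,n)·|q|^{−n}` -/

section Bound

variable (χ : CutoffProfile)

/-- The derivatives of the radial profile `ψ ↦ χ(1,‖ψ‖)` are bounded on `ℂ` (continuous, and zero outside the closed unit disc's
neighbourhood `‖ψ‖ > 1`). [cite: BalabanImbrieJaffe1988, (5.2.3) p.278] -/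
theorem exists_bound_iteratedFDeriv_chi1_norm (n : ℕ) :
    ∃ C : ℝ, 0 ≤ C ∧ ∀ ψ : ℂ, ‖iteratedFDeriv ℝ n (fun ψ : ℂ => χ.χ₁ ‖ψ‖) ψ‖ ≤ C := by
  have hcont : Continuous (iteratedFDeriv ℝ n (fun ψ : ℂ => χ.χ₁ ‖ψ‖)) :=
    (contDiff_chi1_norm χ).continuous_iteratedFDeriv (by exact_mod_cast le_top)
  obtain ⟨C, hC⟩ := (isCompact_closedBall (0 : ℂ) 2).exists_bound_of_continuousOn hcont.continuousOn
  refine ⟨max C 0, le_max_right _ _, fun ψ => ?_⟩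
  by_cases hψ : ψ ∈ Metric.closedBall (0 : ℂ) 2
  · exact (hC ψ hψ).trans (le_max_left _ _)
  · have hgt : 1 < ‖ψ‖ := by
      rw [Metric.mem_closedBall, dist_zero_right] at hψ
      linarith
    have hev : (fun ψ : ℂ => χ.χ₁ ‖ψ‖) =ᶠ[𝓝 ψ] fun _ => (0 : ℝ) := by
      filter_upwards [continuous_norm.continuousAt.eventually_const_lt hgt] with ψ' h'
      exact χ.eq_zero _ (by rw [abs_of_nonneg (norm_nonneg _)]; exact h'.le)
    rw [(hev.iteratedFDeriv ℝ n).eq_of_nhds, iteratedFDeriv_fun_zero, Pi.zero_apply, norm_zero]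
    exact le_max_right _ _

/-- **The bound for the scalar-field χ-factor**: for every order `n` there is `C = C(χ,n) ≥ 0` with
`‖Dⁿ[χ(q, ‖·‖)](φ)‖ ≤ C·|q|^{−n}` for all `q ≠ 0` and all `φ ∈ ℂ` (chain rule for `φ ↦ |q|⁻¹φ`).
[cite: BalabanImbrieJaffe1988, p.307 (Sect. 5.13); (5.2.3)–(5.2.4) p.278] -/
theorem norm_iteratedFDeriv_cutoff_norm_le (n : ℕ) :
    ∃ C : ℝ, 0 ≤ C ∧ ∀ (q : ℝ), q ≠ 0 → ∀ φ : ℂ,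
      ‖iteratedFDeriv ℝ n (fun φ : ℂ => cutoff χ q ‖φ‖) φ‖ ≤ C * |q|⁻¹ ^ n := by
  obtain ⟨C, hC0, hC⟩ := exists_bound_iteratedFDeriv_chi1_norm χ n
  refine ⟨C, hC0, fun q hq φ => ?_⟩
  have hq' : 0 < |q| := abs_pos.mpr hq
  set L : ℂ →L[ℝ] ℂ := (|q|⁻¹ : ℝ) • ContinuousLinearMap.id ℝ ℂ with hL
  have hfun : (fun φ : ℂ => cutoff χ q ‖φ‖) = (fun ψ : ℂ => χ.χ₁ ‖ψ‖) ∘ L := by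
    rw [cutoff_norm_eq_comp χ hq]
    rfl
  have hf : ContDiff ℝ (n : ℕ∞) (fun ψ : ℂ => χ.χ₁ ‖ψ‖) := contDiff_chi1_norm χ
  have hcomp := L.iteratedFDeriv_comp_right (f := fun ψ : ℂ => χ.χ₁ ‖ψ‖) (by exact_mod_cast hf) φ (i := n)
    (by exact_mod_cast le_rfl)
  rw [hfun, hcomp]
  refine (ContinuousMultilinearMap.norm_compContinuousLinearMap_le _ _).trans ?_
  rw [Finset.prod_const, Finset.card_univ, Fintype.card_fin]
  have hLn : ‖L‖ ≤ |q|⁻¹ := by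
    rw [hL, norm_smul, Real.norm_eq_abs, abs_inv, abs_abs]
    exact mul_le_of_le_one_right (inv_nonneg.mpr hq'.le) ContinuousLinearMap.norm_id_le
  exact mul_le_mul (hC _) (pow_le_pow_left₀ (norm_nonneg _) hLn n) (by positivity) hC0

/-- **Bound × support in one line**: for `n ≥ 1` there is `C = C(χ,n) ≥ 0` with
`‖Dⁿ[χ(q,‖·‖)](φ)‖ ≤ C|q|^{−n}·𝟙{(9/10)|q| ≤ ‖φ‖ ≤ |q|}` for all `q ≠ 0`, `φ`. [cite: BalabanImbrieJaffe1988, p.307 (Sect. 5.13)] -/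
theorem norm_iteratedFDeriv_cutoff_norm_le_indicator {n : ℕ} (hn : 1 ≤ n) :
    ∃ C : ℝ, 0 ≤ C ∧ ∀ (q : ℝ), q ≠ 0 → ∀ φ : ℂ,
      ‖iteratedFDeriv ℝ n (fun φ : ℂ => cutoff χ q ‖φ‖) φ‖ ≤
        C * |q|⁻¹ ^ n * Set.indicator {ψ : ℂ | 9 / 10 * |q| ≤ ‖ψ‖ ∧ ‖ψ‖ ≤ |q|} (fun _ => (1 : ℝ)) φ := by
  obtain ⟨C, hC0, hC⟩ := norm_iteratedFDeriv_cutoff_norm_le χ n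
  refine ⟨C, hC0, fun q hq φ => ?_⟩
  by_cases hφ : φ ∈ {ψ : ℂ | 9 / 10 * |q| ≤ ‖ψ‖ ∧ ‖ψ‖ ≤ |q|}
  · rw [Set.indicator_of_mem hφ, mul_one]
    exact hC q hq φ
  · rw [Set.indicator_of_notMem hφ, mul_zero]
    have h0 : iteratedFDeriv ℝ n (fun φ : ℂ => cutoff χ q ‖φ‖) φ = 0 := by
      by_contra hne
      exact hφ (norm_mem_shell_of_iteratedFDeriv_cutoff_norm_ne_zero χ hn hq hne)
    rw [h0, norm_zero]

end Bound

/-! ## §3 *"produce factors e^{−cp(e_k)²} after integrating with respect to … φ^{(k)″}"* -/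

section Integration

variable (χ : CutoffProfile) {Ω : Type*} [MeasurableSpace Ω]

/-- **Integration against ANY finite measure**: for measurable components `X = Re φ`, `Y = Im φ`, `n ≥ 1`, `q ≠ 0`,
`∫ ‖Dⁿ[χ(q,‖·‖)](φ(ω))‖ dμ ≤ C|q|^{−n}·μ{(9/10)|q| ≤ √(X²+Y²)}`. [cite: BalabanImbrieJaffe1988, p.307 (Sect. 5.13)] -/
theorem integral_norm_iteratedFDeriv_cutoff_norm_le_measureReal {n : ℕ} (hn : 1 ≤ n) :
    ∃ C : ℝ, 0 ≤ C ∧ ∀ (μ : Measure Ω) [IsFiniteMeasure μ] (X Y : Ω → ℝ), Measurable X → Measurable Y →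
      ∀ (q : ℝ), q ≠ 0 →
        ∫ ω, ‖iteratedFDeriv ℝ n (fun φ : ℂ => cutoff χ q ‖φ‖) ((X ω : ℂ) + Y ω * Complex.I)‖ ∂μ ≤
          C * |q|⁻¹ ^ n * μ.real {ω | 9 / 10 * |q| ≤ Real.sqrt (X ω ^ 2 + Y ω ^ 2)} := by
  obtain ⟨C, hC0, hC⟩ := norm_iteratedFDeriv_cutoff_norm_le_indicator χ hn
  refine ⟨C, hC0, ?_⟩
  intro μ _ X Y hXm hYm q hq
  set S : Set Ω := {ω | 9 / 10 * |q| ≤ Real.sqrt (X ω ^ 2 + Y ω ^ 2)} with hS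
  have hSm : MeasurableSet S :=
    measurableSet_le measurable_const ((hXm.pow_const 2).add (hYm.pow_const 2)).sqrt
  set K : ℝ := C * |q|⁻¹ ^ n with hK
  have hK0 : 0 ≤ K := mul_nonneg hC0 (pow_nonneg (inv_nonneg.mpr (abs_nonneg q)) n)
  have hpt : ∀ ω, ‖iteratedFDeriv ℝ n (fun φ : ℂ => cutoff χ q ‖φ‖) ((X ω : ℂ) + Y ω * Complex.I)‖ ≤
      S.indicator (fun _ => K) ω := by
    intro ω
    refine (hC q hq _).trans ?_
    by_cases hω : ω ∈ S
    · rw [Set.indicator_of_mem hω]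
      exact mul_le_of_le_one_right hK0 (Set.indicator_apply_le' (fun _ => le_rfl) (fun _ => zero_le_one))
    · have hω' : ((X ω : ℂ) + Y ω * Complex.I) ∉ {ψ : ℂ | 9 / 10 * |q| ≤ ‖ψ‖ ∧ ‖ψ‖ ≤ |q|} := by
        intro h
        apply hω
        have h1 := h.1
        rw [BIJ88GaussIntegration309Phi.norm_mk_eq_sqrt] at h1
        exact h1
      rw [Set.indicator_of_notMem hω, Set.indicator_of_notMem hω', mul_zero]
  have hint : Integrable (S.indicator fun _ => K) μ := (integrable_const K).indicator hSm
  calc ∫ ω, ‖iteratedFDeriv ℝ n (fun φ : ℂ => cutoff χ q ‖φ‖) ((X ω : ℂ) + Y ω * Complex.I)‖ ∂μ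
      ≤ ∫ ω, S.indicator (fun _ => K) ω ∂μ :=
        integral_mono_of_nonneg (Filter.Eventually.of_forall fun ω => norm_nonneg _) hint (Filter.Eventually.of_forall hpt)
    _ = μ.real S * K := by rw [integral_indicator_const K hSm, smul_eq_mul]
    _ = K * μ.real {ω | 9 / 10 * |q| ≤ Real.sqrt (X ω ^ 2 + Y ω ^ 2)} := by rw [mul_comm]

/-- **p. 307, the Gaussian factor for the scalar field** — *"produce factors e^{−cp(e_k)²} after integrating with respect to …
φ^{(k)″}"*, without independence: on ANY probability space, for `φ = X + iY` whose components have CENTERED Gaussian laws (only the two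
marginal laws are used), `n ≥ 1`, `q ≠ 0`:
`∫ ‖Dⁿ[χ(q,‖·‖)](φ)‖ dP ≤ C|q|^{−n}·(2e^{−(81/400)q²/Var X} + 2e^{−(81/400)q²/Var Y})`. [cite: BalabanImbrieJaffe1988, p.307 (Sect. 5.13)] -/
theorem integral_norm_iteratedFDeriv_cutoff_norm_le_of_hasGaussianLaw {n : ℕ} (hn : 1 ≤ n) :
    ∃ C : ℝ, 0 ≤ C ∧ ∀ (P : Measure Ω) (X Y : Ω → ℝ), HasGaussianLaw X P → HasGaussianLaw Y P → Measurable X → Measurable Y →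
      P[X] = 0 → P[Y] = 0 → ∀ (q : ℝ), q ≠ 0 →
        ∫ ω, ‖iteratedFDeriv ℝ n (fun φ : ℂ => cutoff χ q ‖φ‖) ((X ω : ℂ) + Y ω * Complex.I)‖ ∂P ≤
          C * |q|⁻¹ ^ n *
            (2 * Real.exp (-(81 / 400 * q ^ 2 / Var[X; P])) + 2 * Real.exp (-(81 / 400 * q ^ 2 / Var[Y; P]))) := by
  obtain ⟨C, hC0, hC⟩ := integral_norm_iteratedFDeriv_cutoff_norm_le_measureReal (Ω := Ω) χ hn
  refine ⟨C, hC0, ?_⟩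
  intro P X Y hX hY hXm hYm hX0 hY0 q hq
  haveI := hX.isProbabilityMeasure
  have hK0 : 0 ≤ C * |q|⁻¹ ^ n := mul_nonneg hC0 (pow_nonneg (inv_nonneg.mpr (abs_nonneg q)) n)
  have ha : 0 ≤ 9 / 10 * |q| := by positivity
  have htail := real_sqrt_sq_add_sq_ge_le_of_hasGaussianLaw hX hY hXm hYm hX0 hY0 ha
  have e : ∀ v : ℝ, (9 / 10 * |q|) ^ 2 / (4 * v) = 81 / 400 * q ^ 2 / v := fun v => by
    rw [mul_pow, sq_abs]; ring
  rw [e, e] at htail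
  exact (hC P X Y hXm hYm q hq).trans (mul_le_mul_of_nonneg_left htail hK0)

end Integration

end Literature.MathematicalPhysics.QuantumFieldTheory.BalabanImbrieJaffe1984to88.BIJ88ChiPhiDeriv307
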